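import Summits.HodgeConjecture.CorCM.IrreducibleOddWeightsOrbitBalanceCMFields
import Summits.HodgeConjecture.CorCM.IrreducibleOddWeightsProductSpanConverse
import Summits.HodgeConjecture.CorCM.IrreducibleOddWeightsHodgeGluing
import Summits.HodgeConjecture.CorCM.CMAbelianVarietyDimLeThreePowers
import Literature.NumberTheory.ComplexMultiplication.SharedImaginaryQuadraticFamilies
import HarnessLib

/-!
# THE EXACT CRITERION FOR `A × E_k`: `Hg(A × E_k) = Hg(A) × Hg(E_k)` iff the CM type of `A` has signature defect zero on
# the imaginary quadratic field `k ⊆ K_A` — iff no `A^a × E_k^b` carries a MIXED exceptional Hodge class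

COR-CM (cell `pub-hodgecm2`, binder seat `b16` gen 62, count-neutral claim ORBIT BALANCE, file O5 — CM fields and
realisations; theorems only, no definition, no named fact, no `sorry`).  NEW as stated, hence under `Summits/`.  HONEST
FRAMING: unconditional statements about `dim MT` and about which Hodge classes on `A^a × E^b` are sums of products; no
Hodge class is claimed algebraic or not (except in the last, CONDITIONAL gluing statement); `HC_CM` is neither used nor
asserted.

SETTING.  Two-slot family `{i₀, i₁}`: `K_{i₁}` of degree `2` (an imaginary quadratic field `k`; `Φ_{i₁}` one of its two
types; realisation `A_{i₁} = E_k`, a CM elliptic curve), `j : K_{i₁} → K_{i₀}`, `ι₀ : K_{i₁} → ℂ`, `Φ_{i₀}` ANY CM type of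
`K_{i₀}` (realisation `A = A_{i₀}`, of any dimension, simple or not).  The SIGNATURE DEFECT of `Φ_{i₀}` on `k` is
`Σ_{φ ∈ Φ_{i₀}} sign(φ|_k) = n⁺ − n⁻` (`n^± = #{φ ∈ Φ_{i₀} | φ ∘ j = ι₀, resp. ῑ₀}`).

* **`cmFamilyRank_add_card_eq_pair_iff_sum_ksign_eq_zero`** — `rank(Φ_{i₀}, Φ_{i₁}) + 2 = rank Φ_{i₀} + rank Φ_{i₁} + 1`
  (`Hg(A × E_k) = Hg(A) × Hg(E_k)`) **iff the defect is zero**.  (⟸) file O3 `cmFamilyRank_add_card_eq_pair_of_shadow_eq_zero`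
  (defect zero = `Φ_{i₀}` equidistributed over `k` by the tree's `fibres_balanced_of_sum_ksign_eq_zero`; `k` is normal, a
  Galois pivot); (⟹) the tree's `cmFamilyRank_add_card_lt_of_shared_quadratic` (non-zero defects on both slots; on the
  quadratic slot the defect is `±1`).  Separately: `…_of_sum_ksign_eq_zero`, `cmFamilyRank_add_card_lt_pair_of_sum_ksign_ne_zero`.
* **`forall_hodgeClassesProductSpan_pair_iff_sum_ksign_eq_zero`** — for realisations: EVERY rational Hodge class on EVERY
  `(⨁_j A_{π₁ j}) × (⨁_j A_{π₂ j})` with disjoint slot maps (every `A^a × E_k^b`) is a `ℂ`-combination of exterior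
  products of Hodge classes of the factors **iff the defect is zero** (gen 60 G7
  `cmFamilyRank_add_card_eq_iff_forall_hodgeClassesProductSpan`); `exists_not_hodgeClassesProductSpan_pair_of_sum_ksign_ne_zero`
  (non-zero defect ⟹ a MIXED class on some such product: the Weil classes of `k`, Moonen–Zarhin (0.1) (a) for `E × T`).
* `not_isNondegenerateFamily_pair_quadratic` — in BOTH cases the pair is degenerate (tree
  `not_isNondegenerateFamily_of_shared_imaginary_quadratic`): with defect zero the degeneracy sits inside the powers of
  `A` (`A` is of Weil type relative to `k`), with non-zero defect it is mixed.
* `hodgeConjectureFor_biproduct_pair_of_sum_ksign_eq_zero_of_powSucc` — defect zero: the Hodge conjecture on every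
  `A^a × E_k^b` follows from the Hodge conjecture for the powers of `A` alone (the powers of `E_k` are divisor-generated).

## References

* [MoonenZarhin1999LowDim] B. Moonen, Yu. Zarhin, *Hodge classes on abelian varieties of low dimension*, Math. Ann.
  315 (1999), Thm. (0.1) (a), §3 (3.1), §5 (5.2).
* [Gordon1999HodgeAVSurvey] B. B. Gordon, *A survey of the Hodge conjecture for abelian varieties*, §3 Theorem (proof),
  7.5–7.7, 9.4.3.
* [Deligne1982HodgeCycles] P. Deligne, *Hodge cycles on abelian varieties*, LNM 900 (1982), §4 (Weil classes).
* [Shimura1998] G. Shimura, *Abelian Varieties with Complex Multiplication and Modular Functions*, §8.1, §18.1.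
-/

set_option autoImplicit false

noncomputable section

open scoped BigOperators Classical

open CategoryTheory CategoryTheory.Limits NumberField Module

namespace Summit.HodgeConjecture.CorCM

open Literature.NumberTheory.ComplexMultiplication
open Literature.AlgebraicGeometry.Motives (AbelianVariety CMType)
open Literature.AlgebraicGeometry.Motives.AbelianVariety
open Literature.AlgebraicGeometry.HodgeTheory
open Literature.AlgebraicGeometry.ComplexMultiplication (IsCMTypeRealisation)
open Literature.AlgebraicGeometry.Pohlmann1968

/-! ### §1 Defect zero ⟹ equidistributed over `k`; the quadratic slot has defect `±1` -/

section Defect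

variable {k L : Type} [Field k] [NumberField k] [Field L] [NumberField L]

/-- A quadratic number field is normal over `ℚ` (Mathlib: quadratic extensions are normal). [folklore] -/
theorem normal_of_finrank_eq_two (hk : finrank ℚ k = 2) : Normal ℚ k :=
  haveI : Algebra.IsQuadraticExtension ℚ k := ⟨hk⟩
  inferInstance

/-- **Signature defect zero ⟹ `Φ` is equidistributed over `k`** in the counting form of files O3/O4
(`2·#{φ ∈ Φ | φ ∘ j = z} = #{φ | φ ∘ j = z}` for every `z`). [cite: Gordon1999HodgeAVSurvey, 9.4.3] [cite: Deligne1982HodgeCycles, §4] -/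
theorem shadow_eq_zero_of_sum_ksign_eq_zero [IsTotallyComplex k] (hk : finrank ℚ k = 2) (ι₀ : k →+* ℂ) (j : k →+* L)
    (Φ : CMType L)
    (hd : ∑ φ ∈ Finset.univ.filter (fun φ : L →+* ℂ => φ ∈ Φ.1), (if φ.comp j = ι₀ then (1 : ℚ) else -1) = 0)
    (z : k →+* ℂ) :
    2 * (Finset.univ.filter fun t : L →+* ℂ => t.comp j = z ∧ t ∈ Φ.1).card =
      (Finset.univ.filter fun t : L →+* ℂ => t.comp j = z).card := by
  have h := fibres_balanced_of_sum_ksign_eq_zero hk ι₀ j Φ hd z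
  rw [Set.ncard_eq_toFinset_card', Set.ncard_eq_toFinset_card'] at h
  simp only [Set.toFinset_setOf] at h
  rw [← Finset.card_filter_add_card_filter_not (s := Finset.univ.filter fun t : L →+* ℂ => t.comp j = z)
    (fun t => t ∈ Φ.1), Finset.filter_filter, Finset.filter_filter, ← h, two_mul]

/-- **The defect of a CM type of the quadratic field itself is `±1 ≠ 0`** (the type is one embedding).
[cite: Shimura1998, §18.1] -/
theorem sum_ksign_ne_zero_of_finrank_eq_two [IsCMField k] (hk : finrank ℚ k = 2) (ι₀ : k →+* ℂ) (Ψ : CMType k) :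
    ∑ φ ∈ Finset.univ.filter (fun φ : k →+* ℂ => φ ∈ Ψ.1), (if φ.comp (RingHom.id k) = ι₀ then (1 : ℚ) else -1) ≠ 0 := by
  have hcard : (Finset.univ.filter (fun φ : k →+* ℂ => φ ∈ Ψ.1)).card = 1 := by
    have := two_mul_card_filter_mem_cmType Ψ
    rw [hk] at this
    omega
  obtain ⟨φ₀, hφ₀⟩ := Finset.card_eq_one.1 hcard
  rw [hφ₀, Finset.sum_singleton]
  split_ifs <;> norm_num

end Defect

/-! ### §2 The rank criterion -/

section Rank

variable {I : Type} [Fintype I] {K : I → Type} [∀ i, Field (K i)] [∀ i, NumberField (K i)] [∀ i, IsCMField (K i)]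

/-- **Defect zero ⟹ `Hg(A × E_k) = Hg(A) × Hg(E_k)`**: `cmFamilyRank Φ + 2 = cmTypeRank Φ_{i₀} + cmTypeRank Φ_{i₁} + 1` for the
two-slot family (`[K_{i₁}:ℚ] = 2`, `j : K_{i₁} → K_{i₀}`), whatever `Φ_{i₁}`.  (`k` is a Galois pivot over which `Φ_{i₀}` is
equidistributed.) [cite: Gordon1999HodgeAVSurvey, §3 Theorem (proof), 7.7 and 9.4.3] [cite: Deligne1982HodgeCycles, §4] -/
theorem cmFamilyRank_add_card_eq_pair_of_sum_ksign_eq_zero {i₀ i₁ : I} (h01 : i₀ ≠ i₁) (hI : ∀ l, l = i₀ ∨ l = i₁)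
    (hk : finrank ℚ (K i₁) = 2) (j : K i₁ →+* K i₀) (ι₀ : K i₁ →+* ℂ) (Φ : ∀ i, CMType (K i))
    (hd : ∑ φ ∈ Finset.univ.filter (fun φ : K i₀ →+* ℂ => φ ∈ (Φ i₀).1), (if φ.comp j = ι₀ then (1 : ℚ) else -1) = 0) :
    CMAlgebra.cmFamilyRank Φ + Fintype.card I = (∑ i, cmTypeRank (Φ i)) + 1 := by
  haveI : Normal ℚ (K i₁) := normal_of_finrank_eq_two hk
  exact cmFamilyRank_add_card_eq_pair_of_shadow_eq_zero h01 hI Φ j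
    (shadow_eq_zero_of_sum_ksign_eq_zero hk ι₀ j (Φ i₀) hd)

/-- **Non-zero defect ⟹ `Hg(A × E_k) ⊊ Hg(A) × Hg(E_k)`**: `cmFamilyRank Φ + 2 < cmTypeRank Φ_{i₀} + cmTypeRank Φ_{i₁} + 1`
(the tree's shared-quadratic obstruction; the quadratic slot has defect `±1`).
[cite: Gordon1999HodgeAVSurvey, §3 Theorem (proof) and 7.5] [cite: Deligne1982HodgeCycles, §4] -/
theorem cmFamilyRank_add_card_lt_pair_of_sum_ksign_ne_zero {i₀ i₁ : I} (h01 : i₀ ≠ i₁)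
    (hk : finrank ℚ (K i₁) = 2) (j : K i₁ →+* K i₀) (ι₀ : K i₁ →+* ℂ) (Φ : ∀ i, CMType (K i))
    (hd : ∑ φ ∈ Finset.univ.filter (fun φ : K i₀ →+* ℂ => φ ∈ (Φ i₀).1), (if φ.comp j = ι₀ then (1 : ℚ) else -1) ≠ 0) :
    CMAlgebra.cmFamilyRank Φ + Fintype.card I < (∑ i, cmTypeRank (Φ i)) + 1 := by
  haveI : Nonempty I := ⟨i₀⟩
  exact cmFamilyRank_add_card_lt_of_shared_quadratic hk ι₀ h01 j (RingHom.id (K i₁)) Φ hd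
    (sum_ksign_ne_zero_of_finrank_eq_two hk ι₀ (Φ i₁))

/-- **THE EXACT CRITERION: `Hg(A × E_k) = Hg(A) × Hg(E_k)` iff the signature defect of `Φ_A` on `k` is zero.**
[cite: Gordon1999HodgeAVSurvey, §3 Theorem (proof), 7.5–7.7 and 9.4.3] [cite: Deligne1982HodgeCycles, §4] -/
theorem cmFamilyRank_add_card_eq_pair_iff_sum_ksign_eq_zero {i₀ i₁ : I} (h01 : i₀ ≠ i₁) (hI : ∀ l, l = i₀ ∨ l = i₁)
    (hk : finrank ℚ (K i₁) = 2) (j : K i₁ →+* K i₀) (ι₀ : K i₁ →+* ℂ) (Φ : ∀ i, CMType (K i)) :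
    CMAlgebra.cmFamilyRank Φ + Fintype.card I = (∑ i, cmTypeRank (Φ i)) + 1 ↔
      ∑ φ ∈ Finset.univ.filter (fun φ : K i₀ →+* ℂ => φ ∈ (Φ i₀).1), (if φ.comp j = ι₀ then (1 : ℚ) else -1) = 0 := by
  refine ⟨fun h => ?_, cmFamilyRank_add_card_eq_pair_of_sum_ksign_eq_zero h01 hI hk j ι₀ Φ⟩
  by_contra hd
  exact absurd h (ne_of_lt (cmFamilyRank_add_card_lt_pair_of_sum_ksign_ne_zero h01 hk j ι₀ Φ hd))

/-- **In both cases the pair is DEGENERATE** (exceptional Hodge classes on some `A^a × E_k^b`; the criterion only decides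
whether they are MIXED): the tree's theorem for a shared imaginary quadratic field, recorded for this setting.
[cite: Gordon1999HodgeAVSurvey, 7.5–7.6.1 and 9.4.3] -/
theorem not_isNondegenerateFamily_pair_quadratic {i₀ i₁ : I} (h01 : i₀ ≠ i₁) (hk : finrank ℚ (K i₁) = 2)
    (j : K i₁ →+* K i₀) (Φ : ∀ i, CMType (K i)) : ¬ CMAlgebra.IsNondegenerateFamily Φ :=
  not_isNondegenerateFamily_of_shared_imaginary_quadratic hk h01 j (RingHom.id (K i₁)) Φ

end Rank

/-! ### §3 Realisations: mixed exceptional classes on `A^a × E_k^b` iff the defect is non-zero -/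

section Hodge

variable {I : Type} [Fintype I] {K : I → Type} [∀ i, Field (K i)] [∀ i, NumberField (K i)] [∀ i, IsCMField (K i)]
  {Φ : ∀ i, CMType (K i)} {A : I → AbelianVariety ℂ} {ιA : ∀ i, 𝓞 (K i) →+* End (A i)}
  {θ : ∀ i, K i →+* Module.End ℂ (complexBetti (A i).X 1)}

/-- **EVERY HODGE CLASS ON EVERY `A^a × E_k^b` IS A SUM OF PRODUCTS ⟺ THE DEFECT IS ZERO.**  Realisations `A_i ⊨ (K_i; Φ_i)`
of the two-slot family (`A_{i₁} = E_k`); the left side quantifies over all disjoint slot maps `π₁ : Fin N₁ → I`,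
`π₂ : Fin N₂ → I` (all `A^a × E_k^b`, `E_k^b × A^a`, with any bracketing). [cite: MoonenZarhin1999LowDim, Thm. (0.1) (a) and §3 (3.1)]
[cite: Gordon1999HodgeAVSurvey, 7.5–7.7 and 9.4.3] -/
theorem forall_hodgeClassesProductSpan_pair_iff_sum_ksign_eq_zero {i₀ i₁ : I} (h01 : i₀ ≠ i₁)
    (hI : ∀ l, l = i₀ ∨ l = i₁) (hk : finrank ℚ (K i₁) = 2) (j : K i₁ →+* K i₀) (ι₀ : K i₁ →+* ℂ)
    (hA : ∀ i, IsCMTypeRealisation (Φ i) (A i) (ιA i) (θ i)) :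
    (∀ (N₁ N₂ : ℕ) [NeZero N₁] [NeZero N₂] (π₁ : Fin N₁ → I) (π₂ : Fin N₂ → I), (∀ j₁ j₂, π₁ j₁ ≠ π₂ j₂) →
        HodgeClassesProductSpan (⨁ fun l => A (π₁ l)) (⨁ fun l => A (π₂ l))) ↔
      ∑ φ ∈ Finset.univ.filter (fun φ : K i₀ →+* ℂ => φ ∈ (Φ i₀).1), (if φ.comp j = ι₀ then (1 : ℚ) else -1) = 0 := by
  haveI : Nonempty I := ⟨i₀⟩
  exact (cmFamilyRank_add_card_eq_iff_forall_hodgeClassesProductSpan hA).symm.trans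
    (cmFamilyRank_add_card_eq_pair_iff_sum_ksign_eq_zero h01 hI hk j ι₀ Φ)

/-- **Non-zero defect ⟹ a MIXED exceptional Hodge class**: some `(⨁_l A_{π₁ l}) × (⨁_l A_{π₂ l})` with disjoint slot maps
carries a rational Hodge class which is not a combination of exterior products of Hodge classes of the factors (the Weil
classes of `k`; `E × T` of Moonen–Zarhin (0.1) (a) is the case `[K_{i₀} : k] = 3`). [cite: MoonenZarhin1999LowDim, Thm. (0.1) (a)]
[cite: Gordon1999HodgeAVSurvey, 7.5 and 9.4.3] -/
theorem exists_not_hodgeClassesProductSpan_pair_of_sum_ksign_ne_zero {i₀ i₁ : I} (h01 : i₀ ≠ i₁)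
    (hk : finrank ℚ (K i₁) = 2) (j : K i₁ →+* K i₀) (ι₀ : K i₁ →+* ℂ)
    (hA : ∀ i, IsCMTypeRealisation (Φ i) (A i) (ιA i) (θ i))
    (hd : ∑ φ ∈ Finset.univ.filter (fun φ : K i₀ →+* ℂ => φ ∈ (Φ i₀).1), (if φ.comp j = ι₀ then (1 : ℚ) else -1) ≠ 0) :
    ∃ (N₁ N₂ : ℕ) (_ : NeZero N₁) (_ : NeZero N₂) (π₁ : Fin N₁ → I) (π₂ : Fin N₂ → I),
      (∀ j₁ j₂, π₁ j₁ ≠ π₂ j₂) ∧ ¬ HodgeClassesProductSpan (⨁ fun l => A (π₁ l)) (⨁ fun l => A (π₂ l)) := by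
  haveI : Nonempty I := ⟨i₀⟩
  exact exists_not_hodgeClassesProductSpan_of_cmFamilyRank_add_card_ne hA
    (ne_of_lt (cmFamilyRank_add_card_lt_pair_of_sum_ksign_ne_zero h01 hk j ι₀ Φ hd))

/-- **Defect zero: the Hodge conjecture on every `A^a × E_k^b` from the powers of `A` alone** (the powers of the CM
elliptic curve are divisor-generated, tree `CMAbelianVarietyDimLeThreePowers`). [cite: MoonenZarhin1999LowDim, §3 (3.1) and §5 (5.2)]
[cite: vanGeemen1994HodgeAV, §3.5–3.7 Lemma 3.7 (p. 236)] -/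
theorem hodgeConjectureFor_biproduct_pair_of_sum_ksign_eq_zero_of_powSucc {i₀ i₁ : I} (h01 : i₀ ≠ i₁)
    (hI : ∀ l, l = i₀ ∨ l = i₁) (hk : finrank ℚ (K i₁) = 2) (j : K i₁ →+* K i₀) (ι₀ : K i₁ →+* ℂ)
    (hd : ∑ φ ∈ Finset.univ.filter (fun φ : K i₀ →+* ℂ => φ ∈ (Φ i₀).1), (if φ.comp j = ι₀ then (1 : ℚ) else -1) = 0)
    (hA : ∀ i, IsCMTypeRealisation (Φ i) (A i) (ιA i) (θ i))
    (hHC : ∀ N : ℕ, HodgeConjectureFor ((A i₀).powSucc N).dim ((A i₀).powSucc N).X)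
    {J : Type} [Fintype J] [Nonempty J] (π : J → I) :
    HodgeConjectureFor (⨁ fun l => A (π l)).dim (⨁ fun l => A (π l)).X := by
  refine hodgeConjectureFor_biproduct_of_cmFamilyRank_add_card_eq
    (cmFamilyRank_add_card_eq_pair_of_sum_ksign_eq_zero h01 hI hk j ι₀ Φ hd) hA (fun i N => ?_) π
  rcases hI i with rfl | rfl
  · exact hHC N
  · -- the CM elliptic curve: its powers are divisor-generated
    have hdim : (A i).dim = finrank ℚ (K i) / 2 := Literature.AlgebraicGeometry.Motives.schemeDim_eq_holds (hA i).1
    exact hodgeConjectureFor_of_isDivisorGenerated _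
      (isDivisorGenerated_powSucc_of_isOfCMType_of_dim_le_three (hA i).isOfCMType (by omega) N)

end Hodge

end Summit.HodgeConjecture.CorCM

end
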